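import Literature.Analysis.FluidPDE.EulerReynolds
import Literature.Analysis.FunctionSpaces.TorusEnstrophyOrthogonality
import Literature.Analysis.FunctionSpaces.TorusMollifierEstimates
import HarnessLib

/-!
# The symmetric antidivergence expansion of an oscillatory product `(ΔΦ) c` on the flat torus

Analysis/FluidPDE support file for the convex-integration step of A. Cheskidov, X. Luo, *Sharp
nonuniqueness for the Navier–Stokes equations*, Invent. Math. 229 (2022) = arXiv:2009.06596,
§4.5 and §5.3: there the gain of `σ⁻¹` in the new Reynolds stress ("typical in the convex
integration, we can gain a factor of `σ⁻¹` … by inverting the divergence") is obtained through the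
antidivergence `ℛ` and its bilinear version `ℬ(v, A) = vℛA - ℛ(∇v ℛA)` (§7.3, Thm. 7.4:
`div ℬ(v, A) = vA - ⨍ vA`), bounded on `L^p` by Calderón–Zygmund theory (Thm. 7.3). This file
proves the ELEMENTARY pointwise identity that replaces `ℬ` when the oscillatory factor is an
explicit Laplacian, as it is for the Mikado objects of the scheme (`ψ = Δφ`, `φ = ΔΘ`,
`MikadoFlows`): for smooth `c : 𝕋^d → ℝ^d` and `Φ : 𝕋^d → ℝ`,

  `(ΔΦ) c = div S - ∇π - r`,  `S_{ij} = cᵢ ∂ⱼΦ + cⱼ ∂ᵢΦ` (symmetric, `tr S = 2π`),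
  `π = c · ∇Φ`,  `r = ∑ⱼ ∂ⱼΦ ∂ⱼc + (div c) ∇Φ - ∑ⱼ (∇Φ)ⱼ ∇cⱼ`

(`Torus.laplacian_smul_eq_expansion`, componentwise, and `…'`, vector form; product rule and
Schwarz `∂ᵢ∂ⱼ = ∂ⱼ∂ᵢ`, `Torus.partialDeriv_comm`). With `Φ = σ⁻² Φ₀(σ·)` (so `ΔΦ = (ΔΦ₀)(σ·)`,
`∇Φ = σ⁻¹ (∇Φ₀)(σ·)`) every term of `S`, `π`, `r` carries one factor `σ⁻¹`: the symmetric part `S`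
goes into the stress (its trace into the pressure), `π` into the pressure, and only the remainder
`r` — first order in `c`, and small — still needs an antidivergence, of which only
`L²`-boundedness is then required. The tensor is stored by columns (`expansionTensor c Φ y j` is
the `j`-th column), the convention of `Torus.tensorDivergence` / `Torus.IsNSReynoldsOn`.

Everything is proved; no named facts. Part of the decomposition of
`Torus.CheskidovLuo2022ConvexIntegration` (CL22 Prop. 4.1, `NavierStokesReynoldsSteps`).

## References

* A. Cheskidov, X. Luo, Invent. Math. 229 (2022) = arXiv:2009.06596, §4.5 (4.17)–(4.19), §7.3
  Thm. 7.4 (the bilinear antidivergence this identity replaces). [`CheskidovLuo2022`]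
-/

noncomputable section

open Set Function
open scoped InnerProductSpace ContDiff

namespace Literature.Analysis.FluidPDE

namespace Torus

open FunctionSpaces FunctionSpaces.Torus

variable {d : Type*} [Fintype d] [DecidableEq d]

variable (c : UnitAddTorus d → EuclideanSpace ℝ d) (Φ : UnitAddTorus d → ℝ)

/-- The symmetric tensor `S_{ij} = cᵢ ∂ⱼΦ + cⱼ ∂ᵢΦ`, stored by columns: column `j` is
`∂ⱼΦ • c + cⱼ • ∇Φ`. [folklore] -/
def expansionTensor (y : UnitAddTorus d) (j : d) : EuclideanSpace ℝ d :=
  partialDeriv j Φ y • c y + c y j • gradient Φ y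

/-- The pressure `π = c · ∇Φ` of the expansion. [folklore] -/
def expansionPressure (y : UnitAddTorus d) : ℝ := ⟪c y, gradient Φ y⟫_ℝ

/-- The remainder `r = ∑ⱼ ∂ⱼΦ ∂ⱼc + (div c) ∇Φ - ∑ⱼ (∇Φ)ⱼ ∇cⱼ` (first order in `c` and in `Φ`). [folklore] -/
def expansionRemainder (y : UnitAddTorus d) : EuclideanSpace ℝ d :=
  ∑ j, partialDeriv j Φ y • partialDeriv j c y + divergence c y • gradient Φ y -
    ∑ j, gradient Φ y j • gradient (fun z => c z j) y

variable {c Φ}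


/-- `∂ⱼ(f + g) = ∂ⱼf + ∂ⱼg`, pointwise, for `C¹` real functions (pointwise form of the accepted
`Torus.partialDeriv_add`; same statement as `Torus.partialDeriv_add_apply` of `FluidPDE/Antidivergence`,
deliberately not imported). [folklore] -/
private theorem partialDeriv_add_fun {f g : UnitAddTorus d → ℝ} (hf : IsContDiff 1 f) (hg : IsContDiff 1 g) (j : d) (y : UnitAddTorus d) :
    partialDeriv j (fun z => f z + g z) y = partialDeriv j f y + partialDeriv j g y :=
  congr_fun (partialDeriv_add hf hg j) y

omit [DecidableEq d] in
/-- `⟪v, w⟫ = ∑ᵢ vᵢ wᵢ` on `ℝ^d` (same statement as `Torus.inner_eq_sum_mul` of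
`FluidPDE/CoarseGrainingEstimates`, not imported here to keep the import closure small). [folklore] -/
private theorem inner_eq_sum_mul_apply (v w : EuclideanSpace ℝ d) : ⟪v, w⟫_ℝ = ∑ i, v i * w i := by
  simp [EuclideanSpace.inner_eq_star_dotProduct, dotProduct, mul_comm]

/-- **The expansion identity, componentwise**: `(ΔΦ) cᵢ = (div S)ᵢ - ∂ᵢπ - rᵢ` for smooth `c`, `Φ`
(product rule; the terms `cⱼ(∂ⱼ∂ᵢΦ - ∂ᵢ∂ⱼΦ)` cancel by Schwarz). [folklore] -/
theorem laplacian_smul_eq_expansion (hc : IsSmooth c) (hΦ : IsSmooth Φ) (y : UnitAddTorus d) (i : d) :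
    laplacian Φ y * c y i =
      tensorDivergence (expansionTensor c Φ) y i - gradient (expansionPressure c Φ) y i - expansionRemainder c Φ y i := by
  -- smoothness bookkeeping
  have hci : ∀ j, IsSmooth fun z => c z j := fun j => hc.apply j
  have hdΦ : ∀ j, IsSmooth (partialDeriv j Φ) := fun j => hΦ.partialDeriv j
  have h1 : ∀ {f : UnitAddTorus d → ℝ}, IsSmooth f → IsContDiff 1 f := fun hf => hf.isContDiff (by simp)
  have hm1 : ∀ j k, IsSmooth (fun z => partialDeriv j Φ z * c z k) := fun j k => (hdΦ j).mul (hci k)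
  have hm2 : ∀ j k, IsSmooth (fun z => c z k * partialDeriv j Φ z) := fun j k => (hci k).mul (hdΦ j)
  -- entries of the tensor as scalar functions
  have hS : ∀ j, (fun z => expansionTensor c Φ z j i) = fun z => partialDeriv j Φ z * c z i + c z j * partialDeriv i Φ z := by
    intro j; funext z
    simp [expansionTensor, gradient_apply (h1 hΦ)]
  -- (A) the divergence term
  have hA : tensorDivergence (expansionTensor c Φ) y i =
      ∑ j, (partialDeriv j Φ y * partialDeriv j (fun z => c z i) y + partialDeriv j (partialDeriv j Φ) y * c y i +
        (c y j * partialDeriv j (partialDeriv i Φ) y + partialDeriv j (fun z => c z j) y * partialDeriv i Φ y)) := by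
    have hsm : ∀ j, IsSmooth fun z => expansionTensor c Φ z j := fun j =>
      ((hdΦ j).smul' hc).add ((hci j).smul' hΦ.gradient)
    rw [tensorDivergence]
    simp only [WithLp.ofLp_sum, Finset.sum_apply]
    refine Finset.sum_congr rfl fun j _ => ?_
    rw [← partialDeriv_apply_coord ((hsm j).isContDiff (by simp)) j y i, hS j,
      partialDeriv_add_fun (h1 (hm1 j i)) (h1 (hm2 i j)),
      partialDeriv_mul (h1 (hdΦ j)) (h1 (hci i)), partialDeriv_mul (h1 (hci j)) (h1 (hdΦ i))]
  -- (B) the pressure gradient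
  have hπ : expansionPressure c Φ = fun z => ∑ j, c z j * partialDeriv j Φ z := by
    funext z
    rw [expansionPressure, inner_eq_sum_mul_apply]
    exact Finset.sum_congr rfl fun j _ => by rw [gradient_apply (h1 hΦ)]
  have hB : gradient (expansionPressure c Φ) y i =
      ∑ j, (c y j * partialDeriv i (partialDeriv j Φ) y + partialDeriv i (fun z => c z j) y * partialDeriv j Φ y) := by
    have hsm : IsSmooth (expansionPressure c Φ) := hc.inner hΦ.gradient
    rw [gradient_apply (h1 hsm), hπ, partialDeriv_finset_sum _ (fun j _ => h1 (hm2 j j))]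
    exact Finset.sum_congr rfl fun j _ => partialDeriv_mul (h1 (hci j)) (h1 (hdΦ j)) i y
  -- (C) the remainder
  have hC : expansionRemainder c Φ y i =
      ∑ j, partialDeriv j Φ y * partialDeriv j (fun z => c z i) y +
        (∑ j, partialDeriv j (fun z => c z j) y) * partialDeriv i Φ y -
        ∑ j, partialDeriv j Φ y * partialDeriv i (fun z => c z j) y := by
    rw [expansionRemainder]
    simp only [PiLp.sub_apply, PiLp.add_apply, WithLp.ofLp_sum, Finset.sum_apply, PiLp.smul_apply, smul_eq_mul,
      divergence, gradient_apply (h1 hΦ), gradient_apply (h1 (hci _)), partialDeriv_apply_coord (hc.isContDiff (by simp))]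
  -- (D) the Laplacian and Schwarz
  rw [laplacian_eq_sum_partialDeriv_partialDeriv hΦ, hA, hB, hC]
  have hsch : ∀ j, partialDeriv j (partialDeriv i Φ) y = partialDeriv i (partialDeriv j Φ) y :=
    fun j => partialDeriv_comm hΦ j i y
  simp only [hsch, Finset.sum_mul, ← Finset.sum_add_distrib, ← Finset.sum_sub_distrib]
  exact Finset.sum_congr rfl fun j _ => by ring


/-- The expansion tensor is symmetric. [folklore] -/
theorem expansionTensor_symm (hΦ : IsSmooth Φ) (y : UnitAddTorus d) (i j : d) :
    expansionTensor c Φ y j i = expansionTensor c Φ y i j := by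
  have h1 : IsContDiff 1 Φ := hΦ.isContDiff (by simp)
  simp [expansionTensor, gradient_apply h1]
  ring

/-- The trace of the expansion tensor is `2π`. [folklore] -/
theorem expansionTensor_trace (hΦ : IsSmooth Φ) (y : UnitAddTorus d) :
    ∑ i, expansionTensor c Φ y i i = 2 * expansionPressure c Φ y := by
  have h1 : IsContDiff 1 Φ := hΦ.isContDiff (by simp)
  simp only [expansionTensor, expansionPressure, inner_eq_sum_mul_apply, PiLp.add_apply, PiLp.smul_apply, smul_eq_mul,
    gradient_apply h1, Finset.mul_sum]
  exact Finset.sum_congr rfl fun i _ => by ring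

/-- **Vector form of the expansion identity**: `(ΔΦ) c = div S - ∇π - r`. [folklore] -/
theorem laplacian_smul_eq_expansion' (hc : IsSmooth c) (hΦ : IsSmooth Φ) (y : UnitAddTorus d) :
    laplacian Φ y • c y =
      tensorDivergence (expansionTensor c Φ) y - gradient (expansionPressure c Φ) y - expansionRemainder c Φ y := by
  ext i
  simpa using laplacian_smul_eq_expansion hc hΦ y i

/-- The expansion tensor of smooth data is smooth (as a `d → ℝ^d`-valued field). [folklore] -/
theorem isSmooth_expansionTensor (hc : IsSmooth c) (hΦ : IsSmooth Φ) : IsSmooth (expansionTensor c Φ) := by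
  unfold IsSmooth
  refine contDiff_pi.2 fun j => ?_
  exact ((hΦ.partialDeriv j).smul' hc).add ((hc.apply j).smul' hΦ.gradient)

omit [DecidableEq d] in
/-- The expansion pressure of smooth data is smooth. [folklore] -/
theorem isSmooth_expansionPressure (hc : IsSmooth c) (hΦ : IsSmooth Φ) : IsSmooth (expansionPressure c Φ) :=
  hc.inner hΦ.gradient

/-- The expansion remainder of smooth data is smooth. [folklore] -/
theorem isSmooth_expansionRemainder (hc : IsSmooth c) (hΦ : IsSmooth Φ) : IsSmooth (expansionRemainder c Φ) := by
  refine IsSmooth.sub (IsSmooth.add ?_ (hc.divergence.smul' hΦ.gradient)) ?_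
  · exact ContDiff.sum fun j _ => (hΦ.partialDeriv j).smul' (hc.partialDeriv j)
  · exact ContDiff.sum fun j _ => (hΦ.gradient.apply j).smul' (hc.apply j).gradient

end Torus

end Literature.Analysis.FluidPDE
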